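import Summits.KontsevichZagierPeriods.KontsevichZagierPeriods.Theorems.HermiteRigidityPadeBoxIslands
import Summits.KontsevichZagierPeriods.KontsevichZagierPeriods.Theorems.HermiteRigidityEllipticSectorComplementStrength

/-!
# KontsevichZagierPeriods / HermiteRigidity — `IslandComplement` (stmt-KontsevichZagierPeriods-15935) is summit-strength

Route `KontsevichZagierPeriods/HermiteRigidity`, crux stmt-KontsevichZagierPeriods-15935 (`IslandComplement`,
rank 5, the single open leaf of the `closes`-cone after `PadeBoxIslands` landed). STRENGTH RECORD (pure
composition of landed route theorems, no analysis): with the Padé box islands proved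
(`padeBoxIslands_proof`, stmt-15909), the island complement is literally equivalent to the kernel form of
Conjecture 1 and hence to the summit statement:

* `kernelForm_of_islandComplement` — `IslandComplement →  ∀ c, KZ.eval c = 0 → c ∈ KZ.relations`
  (modus ponens with the two islands);
* `kontsevichZagierPeriods_of_islandComplement` — `IslandComplement → KontsevichZagierPeriods`
  (kernel form, `reductionRigidityOfKernelForm_proof` = the split glue `ReductionRigidityOfIslands`, then
  the deciding theorem `closes` with `rigidKernel_proof`);
* `islandComplement_of_kontsevichZagierPeriods` — the converse (the summit gives the kernel form,
  `kernelForm_of_kontsevichZagierPeriods`; the island hypotheses are idle);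
* `islandComplement_iff_kontsevichZagierPeriods`, `islandComplement_iff_kernelForm`.

So no composition of tree theorems can discharge the leaf short of proving Conjecture 1 itself; a proof
of the kernel form on any structural route closes it in one line (`islandComplement_of_kernelForm`).

References: M. Kontsevich, D. Zagier, *Periods* (2001), §1.2, Conjecture 1 [cite: KontsevichZagier2001, §1.2];
A. Huber, S. Müller-Stach, *Periods and Nori Motives* (2017), Conj. 13.2.1.
-/

namespace Summit.KontsevichZagierPeriods.HermiteRigidity.IslandComplement

open Literature.NumberTheory.Transcendental
open Summit.KontsevichZagierPeriods.KontsevichZagierPeriods.Theses.HermiteRigidity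

/-- **Kernel form ⇒ item** (discharge hook): a proof of the kernel form of Conjecture 1 gives
`IslandComplement` outright (the island hypotheses are not used). [cite: KontsevichZagier2001, §1.2] -/
theorem islandComplement_of_kernelForm
    (hK : ∀ c : KZ.FormalRep, KZ.eval c = 0 → c ∈ KZ.relations) :
    Summit.KontsevichZagierPeriods.KontsevichZagierPeriods.Theses.HermiteRigidity.IslandComplement :=
  fun _ _ => hK

/-- **Item ⇒ kernel form**: feed `IslandComplement` with the two proved islands
(`padeBoxIslands_proof`, stmt-15909). [cite: KontsevichZagier2001, §1.2] -/
theorem kernelForm_of_islandComplement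
    (hC : Summit.KontsevichZagierPeriods.KontsevichZagierPeriods.Theses.HermiteRigidity.IslandComplement) :
    ∀ c : KZ.FormalRep, KZ.eval c = 0 → c ∈ KZ.relations :=
  hC Summit.KontsevichZagierPeriods.HermiteRigidity.PadeBoxIslands.padeBoxIslands_proof.1
    Summit.KontsevichZagierPeriods.HermiteRigidity.PadeBoxIslands.padeBoxIslands_proof.2

/-- **Item ⇒ summit**: the islands (proved) and the island complement give the kernel form, the
landed glue `reductionRigidityOfKernelForm_proof` (stmt-14406; this is exactly the split glue
`ReductionRigidityOfIslands`, stmt-15957) gives `ReductionRigidity`, and the deciding theorem `closes`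
with the landed `rigidKernel_proof` gives the summit statement. [cite: KontsevichZagier2001, §1.2] -/
theorem kontsevichZagierPeriods_of_islandComplement
    (hC : Summit.KontsevichZagierPeriods.KontsevichZagierPeriods.Theses.HermiteRigidity.IslandComplement) :
    _root_.KontsevichZagierPeriods :=
  -- buildfix 2026-08-20 (ops-buildfix lane, proof-only): the route HermiteRigidity is CLOSED and its
  -- deciding theorem `closes` was stripped from the route file; `closes … rigidKernel_proof` is exactly the
  -- landed `kontsevichZagierPeriods_of_reductionRigidity` of the imported EllipticSectorComplementStrength
  -- module (itself the landed `HermiteRigidity.Assembly.assembly_proof`).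
  Summit.KontsevichZagierPeriods.HermiteRigidity.EllipticSectorComplement.kontsevichZagierPeriods_of_reductionRigidity
    (Summit.KontsevichZagierPeriods.HermiteRigidity.ReductionRigidityOfKernelForm.reductionRigidityOfKernelForm_proof
      (kernelForm_of_islandComplement hC))

/-- **Summit ⇒ item**: the summit gives the kernel form (`kernelForm_of_kontsevichZagierPeriods`),
hence the item. [cite: KontsevichZagier2001, §1.2] -/
theorem islandComplement_of_kontsevichZagierPeriods (hS : _root_.KontsevichZagierPeriods) :
    Summit.KontsevichZagierPeriods.KontsevichZagierPeriods.Theses.HermiteRigidity.IslandComplement :=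
  islandComplement_of_kernelForm
    (Summit.KontsevichZagierPeriods.HermiteRigidity.EllipticSectorComplement.kernelForm_of_kontsevichZagierPeriods hS)

/-- **The open leaf `IslandComplement` is literally equivalent to the summit** (as typed in the tree,
with the islands proved). [cite: KontsevichZagier2001, §1.2] -/
theorem islandComplement_iff_kontsevichZagierPeriods :
    Summit.KontsevichZagierPeriods.KontsevichZagierPeriods.Theses.HermiteRigidity.IslandComplement ↔
      _root_.KontsevichZagierPeriods :=
  ⟨kontsevichZagierPeriods_of_islandComplement, islandComplement_of_kontsevichZagierPeriods⟩

/-- **… and to the kernel form of Conjecture 1.** [cite: KontsevichZagier2001, §1.2] -/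
theorem islandComplement_iff_kernelForm :
    Summit.KontsevichZagierPeriods.KontsevichZagierPeriods.Theses.HermiteRigidity.IslandComplement ↔
      ∀ c : KZ.FormalRep, KZ.eval c = 0 → c ∈ KZ.relations :=
  ⟨kernelForm_of_islandComplement, islandComplement_of_kernelForm⟩

end Summit.KontsevichZagierPeriods.HermiteRigidity.IslandComplement
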